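import Literature.AlgebraicGeometry.GroupSchemes.BarsottiTateGroup
import Literature.AlgebraicGeometry.GroupSchemes.GroupSchemeKernel
import Literature.AlgebraicGeometry.AbelianSchemes.AbelianSchemeOverMulNFiniteFlat
import Literature.AlgebraicGeometry.AbelianSchemes.AbelianSchemeQuotientMulNDescent
import Literature.AlgebraicGeometry.AbelianSchemes.AbelianSchemeOverHomNoetherianAnyBase
import HarnessLib

/-!
# The `p`-divisible group `A[p^∞] = (A[p^n])_n` of an abelian scheme over an ARBITRARY base is a Barsotti–Tate group
# of height `2g`

Topic `Literature/AlgebraicGeometry/AbelianSchemes`; namespace `Literature.AlgebraicGeometry.AbelianSchemes.AbelianSchemeOver`.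
Cell `hodgecm-mathlib` (D-0151), FLOOR 0, P6 «MOD programme» generic organ **L4.1** (P6 BRIEF §3; MOD-PLAN v0.9 §4 «`A[p^∞]` of
an abelian scheme is one of height `2g`»; kit desk `F0/P6-kit/BTGroup.desk.A-p07g17.lean`, A-p07 (g17)); sibling of the carrier ★
`GroupSchemes/BarsottiTateGroup` (`BTGroup S p h`, socket `BTGroup.IsOfAbelianScheme`).  `--supports stmt-HodgeConjecture-24832`;
COUNT-NEUTRAL: HC_CM is proved only modulo the 7 printed citations until rung 0 closes; this file discharges none of them.
CONSTRUCTION + THEOREMS (8 `def`, no named fact, no instance, no notation, no `sorry`).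

THE PRINT.  [Tate1967] §2, (2.1) and example (a): for an abelian scheme `A → S` of relative dimension `g`, the system
`(A[p^n], A[p^n] ↪ A[p^{n+1}])` is a `p`-divisible group of height `2g`; [GortzWedhorn2023] Prop. 27.186 («`[n]_X` is an
isogeny of degree `n^{2g}`») and Prop. 27.188 (1) («`X[n]` is a finite locally free group scheme over `S` of rank `n^{2g}`»),
both over an ARBITRARY base and PROVED in the tree (★ `AbelianSchemeOverMulNFiniteFlat`: `flat ∕ isFinite ∕ surjective_pow_id_left_of_ne_zero`,
`finrank_pow_id_left_of_ne_zero`); [Messing1972] Ch. I (1.1)–(1.6).  Nothing here is a new theorem of algebraic geometry: the file is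
the CONSTRUCTION assembling ★ results in Mathlib's group-object currency (`GrpObj` in the cartesian-monoidal `Over S`).

WHAT IS HERE (for `A : AbelianSchemeOver S`, any base scheme `S`): §0 `[N M] = [N] ≫ [M]`, `f ≫ [N] = f ^ N`; §1 **`torsion A N =
A[N] := Ker [N]`** (★ `GroupSchemeKernel.ker`), `torsionι` (mono, closed immersion), `torsionLift` (universal property), the cartesian
squares `isPullback_torsionι(_left)`, and for `N ≠ 0` **`isFinite_torsion_hom ∕ flat_torsion_hom ∕ finrank_torsion_hom (hg) : rank = N ^ (2 g)`**;
§2 **`torsionIncl (N ∣ M) : A[N] ⟶ A[M]`** (mono, closed immersion), **`torsionMulMap (M' = N M) : A[M'] ⟶ A[M]`** induced by `[N]`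
with the CARTESIAN square `isPullback_torsionMulMap : A[N M] = [N]⁻¹ A[M]` ⇒ `flat ∕ surjective ∕ isFinite_torsionMulMap_left`;
§3 (commutative `A`) the group structure **`torsionGrpObj N`** (a reducible `def`, NOT an instance — bind with `letI`; ★ `grpObjKer` over ★
`isMonHom_mulN`), `isCommMonObj_torsion`, **`id_pow_eq_one_torsion : (𝟙 A[N]) ^ N = 1`**, `isMonHom_torsionIncl ∕ _torsionMulMap`,
**`isPullback_torsionIncl : A[N] = Ker([N] on A[M])`** (Tate's exactness), **`torsionMulMap_comp_torsionIncl : j ≫ i = [N]`**;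
§4 **`pDivisibleGroup (A) [IsCommMonObj A.X] (hp : p ≠ 0) (hg : A.IsOfRelDim g) : BTGroup S p (2 * g)`** (all nineteen axioms of the
carrier discharged by §1–§3), `torsionIsoPullback : (A[N]).left ≅ pullback e [N]`, **`isOfAbelianScheme_pDivisibleGroup`** (the socket
holds: `ι` is a homomorphism making `A[p^n]` the kernel of `[p^n]`, `incl ≫ ι = ι`), `exists_btGroup_isOfAbelianScheme` and the binder-free **`exists_btGroup_isOfAbelianScheme_of_isLocallyNoetherian`**
(★ `isCommMonObj_of_isLocallyNoetherian_base`, [MumfordFogartyKirwan1994] Cor. 6.5).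

DESIGN.  `p` is any natural number `≠ 0` (primality is never used by Tate's axioms); the relative dimension enters only the rank;
the arithmetic witnesses `N ∣ M`, `M' = N * M` are PROP arguments used inside proof obligations only, so no transport along
`p ^ (n + 1) = p * p ^ n` is needed (`pow_succ'`, `pow_dvd_pow`).  NOT HERE: the `𝒪_F ⊗ ℤ_p`-decomposition `A[p^∞] = ∏ A[v^∞]`
(MOD-PLAN L4.2), Cartier duality, the connected–étale sequence, Serre–Tate.

## References
* [Tate1967] J. T. Tate, *p-divisible groups*, Proc. Conf. Local Fields (Driebergen 1966), Springer 1967 — §2 (2.1), example (a).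
* [GortzWedhorn2023] U. Görtz, T. Wedhorn, *Algebraic Geometry II* (2023) — Prop. 27.186, Prop. 27.188 (1); [Messing1972] LNM 264, Ch. I.
* [MumfordFogartyKirwan1994] D. Mumford, J. Fogarty, F. Kirwan, *Geometric Invariant Theory*, 3rd ed. (1994) — Ch. 6 §1 Cor. 6.5.
-/

noncomputable section

universe u

open CategoryTheory CategoryTheory.Limits AlgebraicGeometry MonoidalCategory CartesianMonoidalCategory
open scoped MonObj

namespace Literature.AlgebraicGeometry.AbelianSchemes

namespace AbelianSchemeOver

open Literature.AlgebraicGeometry.GroupSchemes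

variable {S : Scheme.{u}} (A : AbelianSchemeOver S)

/-! ## §0 Arithmetic of `[N] = (𝟙 A)^N` in `Hom_S(A, A)` -/

/-- `[N M] = [N] ≫ [M]` on any `S`-group scheme: `(𝟙)^(N M) = ((𝟙)^N)^M = (𝟙)^N ≫ (𝟙)^M` (multiplication by `n` on a group
scheme, `n_X`). [cite: MumfordFogartyKirwan1994, Ch. 6 §1 (p. 115)] -/
theorem mulN_mul (N M : ℕ) : A.mulN (N * M) = A.mulN N ≫ A.mulN M := by
  rw [mulN_def, mulN_def, mulN_def, pow_mul, MonObj.comp_pow, Category.comp_id]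

/-- `f ≫ [N] = f ^ N` for any `T`-valued point `f : T → A` (`n_X` acts on points by the `n`-th power).
[cite: MumfordFogartyKirwan1994, Ch. 6 §1 (p. 115)] -/
theorem comp_mulN {T : Over S} (f : T ⟶ A.X) (N : ℕ) : f ≫ A.mulN N = f ^ N := by
  rw [mulN_def, MonObj.comp_pow, Category.comp_id]

/-! ## §1 The `N`-torsion `A[N]` as an `S`-scheme: finite locally free of rank `N^{2g}` -/

/-- **The `N`-torsion `A[N] := Ker([N] : A → A) = A ×_{[N], A, e} S`** of an abelian scheme over `S`, as an `S`-scheme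
(the group-scheme kernel ★ `GroupSchemeKernel.ker` of `[N] = (𝟙 A)^N`). [cite: GortzWedhorn2023, Prop. 27.188 (1)] -/
def torsion (N : ℕ) : Over S :=
  GroupSchemeKernel.ker (A.mulN N)

/-- The inclusion `ι : A[N] ⟶ A`. [cite: GortzWedhorn2023, Prop. 27.188 (1)] -/
def torsionι (N : ℕ) : A.torsion N ⟶ A.X :=
  GroupSchemeKernel.kerι (A.mulN N)

/-- `ι ≫ [N] = 1`: the `N`-torsion is killed by `[N]` in `Hom_S(A[N], A)`. [cite: GortzWedhorn2023, Prop. 27.188 (1)] -/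
theorem torsionι_comp_mulN (N : ℕ) : A.torsionι N ≫ A.mulN N = 1 :=
  GroupSchemeKernel.kerι_comp _

/-- `ι : A[N] ⟶ A` is a monomorphism. [cite: GortzWedhorn2023, Prop. 27.188 (1)] -/
theorem mono_torsionι (N : ℕ) : Mono (A.torsionι N) :=
  GroupSchemeKernel.mono_kerι _

/-- The defining cartesian square `A[N] →(ι) A →([N]) A ←(e) S` in `Over S`. [cite: GortzWedhorn2023, Prop. 27.188 (1)] -/
theorem isPullback_torsionι (N : ℕ) : IsPullback (A.torsionι N) (toUnit (A.torsion N)) (A.mulN N) η[A.X] := by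
  have h : toUnit (A.torsion N) = pullback.snd (A.mulN N) η[A.X] := toUnit_unique _ _
  rw [h]
  exact IsPullback.of_hasPullback _ _

/-- Two morphisms into `A[N]` agree iff they agree after `ι`. [cite: GortzWedhorn2023, Prop. 27.188 (1)] -/
theorem torsion_hom_ext {N : ℕ} {T : Over S} {a b : T ⟶ A.torsion N} (h : a ≫ A.torsionι N = b ≫ A.torsionι N) :
    a = b :=
  GroupSchemeKernel.ker_hom_ext h

/-- **The universal property of `A[N]`**: a `T`-valued point `f` of `A` with `f ≫ [N] = 1` factors through `A[N]`.
[cite: GortzWedhorn2023, Prop. 27.188 (1)] -/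
def torsionLift {N : ℕ} {T : Over S} (f : T ⟶ A.X) (hf : f ≫ A.mulN N = 1) : T ⟶ A.torsion N :=
  GroupSchemeKernel.kerLift f hf

/-- `torsionLift f _ ≫ ι = f`. [cite: GortzWedhorn2023, Prop. 27.188 (1)] -/
@[reassoc (attr := simp)]
theorem torsionLift_ι {N : ℕ} {T : Over S} (f : T ⟶ A.X) (hf : f ≫ A.mulN N = 1) :
    A.torsionLift f hf ≫ A.torsionι N = f :=
  GroupSchemeKernel.kerLift_ι f hf

/-- The underlying square of schemes `A[N] → A →([N]) A ← S` is cartesian. [cite: GortzWedhorn2023, Prop. 27.188 (1)] -/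
theorem isPullback_torsionι_left (N : ℕ) :
    IsPullback (A.torsionι N).left (A.torsion N).hom (A.mulN N).left (η[A.X] : 𝟙_ (Over S) ⟶ A.X).left :=
  (A.isPullback_torsionι N).map (Over.forget S)

/-- **`A[N] → S` is FINITE** for `N ≠ 0` (base change of the finite `[N]`, ★ `isFinite_pow_id_left_of_ne_zero`).
[cite: GortzWedhorn2023, Prop. 27.188 (1)] -/
theorem isFinite_torsion_hom {N : ℕ} (hN : N ≠ 0) : IsFinite (A.torsion N).hom :=
  MorphismProperty.of_isPullback (P := @IsFinite) (A.isPullback_torsionι_left N)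
    (A.isFinite_pow_id_left_of_ne_zero hN)

/-- **`A[N] → S` is FLAT** for `N ≠ 0` (base change of the flat `[N]`, ★ `flat_pow_id_left_of_ne_zero`).
[cite: GortzWedhorn2023, Prop. 27.188 (1)] -/
theorem flat_torsion_hom {N : ℕ} (hN : N ≠ 0) : Flat (A.torsion N).hom :=
  MorphismProperty.of_isPullback (P := @Flat) (A.isPullback_torsionι_left N)
    (A.flat_pow_id_left_of_ne_zero hN)

/-- **`A[N] → S` is finite locally free OF RANK `N^{2g}`** at every point of `S`, `g` the relative dimension
(★ `finrank_pow_id_left_of_ne_zero` read through the cartesian square). [cite: GortzWedhorn2023, Prop. 27.188 (1)] -/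
theorem finrank_torsion_hom {g N : ℕ} (hg : A.IsOfRelDim g) (hN : N ≠ 0) (s : S) :
    Scheme.Hom.finrank (A.torsion N).hom s = N ^ (2 * g) := by
  haveI : Flat (A.mulN N).left := A.flat_pow_id_left_of_ne_zero hN
  haveI : IsFinite (A.mulN N).left := A.isFinite_pow_id_left_of_ne_zero hN
  rw [Scheme.Hom.finrank_of_isPullback _ _ _ _ (A.isPullback_torsionι_left N) s]
  exact A.finrank_pow_id_left_of_ne_zero hg hN _

/-- `ι : A[N] → A` is a CLOSED IMMERSION on underlying schemes (`A → S` is separated).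
[cite: GortzWedhorn2023, Prop. 27.188 (1)] -/
theorem isClosedImmersion_torsionι_left (N : ℕ) : IsClosedImmersion (A.torsionι N).left := by
  haveI := A.isProper
  exact GroupSchemeKernel.isClosedImmersion_kerι_left_of_isSeparated _

/-! ## §2 The inclusions `A[N] ↪ A[M]` (`N ∣ M`) and the maps `[N] : A[N M] → A[M]` -/

/-- **The inclusion `i : A[N] ⟶ A[M]` for `N ∣ M`** (`ι_N ≫ [M] = ι_N ≫ [N] ≫ [M∕N] = 1`, universal property of
`A[M] = Ker [M]`); the datum does not depend on the divisibility witness. [cite: Tate1967, §2 (2.1)] -/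
def torsionIncl (N M : ℕ) (h : N ∣ M) : A.torsion N ⟶ A.torsion M :=
  A.torsionLift (A.torsionι N) (by
    obtain ⟨k, rfl⟩ := h
    rw [mulN_mul, ← Category.assoc, torsionι_comp_mulN, comp_mulN, one_pow])

/-- `i ≫ ι_M = ι_N`. [cite: Tate1967, §2 (2.1)] -/
@[reassoc (attr := simp)]
theorem torsionIncl_ι (N M : ℕ) (h : N ∣ M) : A.torsionIncl N M h ≫ A.torsionι M = A.torsionι N :=
  A.torsionLift_ι _ _

/-- `i : A[N] ⟶ A[M]` is a monomorphism. [cite: Tate1967, §2 (2.1)] -/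
theorem mono_torsionIncl (N M : ℕ) (h : N ∣ M) : Mono (A.torsionIncl N M h) := by
  haveI := A.mono_torsionι N
  exact mono_of_mono_fac (A.torsionIncl_ι N M h)

/-- `i : A[N] ⟶ A[M]` is a CLOSED IMMERSION on underlying schemes (`i ≫ ι_M = ι_N` with `ι_N`, `ι_M` closed immersions).
[cite: Tate1967, §2 (2.1)] -/
theorem isClosedImmersion_torsionIncl_left (N M : ℕ) (h : N ∣ M) : IsClosedImmersion (A.torsionIncl N M h).left := by
  haveI := A.isClosedImmersion_torsionι_left M
  haveI : IsClosedImmersion ((A.torsionIncl N M h).left ≫ (A.torsionι M).left) := by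
    rw [← Over.comp_left, torsionIncl_ι]
    exact A.isClosedImmersion_torsionι_left N
  exact IsClosedImmersion.of_comp_isClosedImmersion _ (A.torsionι M).left

/-- **The map `j : A[M′] ⟶ A[M]` induced by `[N]`** for `M′ = N M` (`(ι ≫ [N]) ≫ [M] = ι ≫ [N M] = 1`); the datum does
not depend on the arithmetic witness. [cite: Tate1967, §2 (2.1)] -/
def torsionMulMap (N M M' : ℕ) (hM : M' = N * M) : A.torsion M' ⟶ A.torsion M :=
  A.torsionLift (A.torsionι M' ≫ A.mulN N) (by
    rw [Category.assoc, ← mulN_mul, ← hM, torsionι_comp_mulN])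

/-- `j ≫ ι_M = ι_{M′} ≫ [N]`. [cite: Tate1967, §2 (2.1)] -/
@[reassoc]
theorem torsionMulMap_ι (N M M' : ℕ) (hM : M' = N * M) :
    A.torsionMulMap N M M' hM ≫ A.torsionι M = A.torsionι M' ≫ A.mulN N :=
  A.torsionLift_ι _ _

/-- `[N] ≫ [M] = [N M]`-compatibility of the defining squares: **the square `A[N M] →(j) A[M]; ι ↓ ↓ ι; A →([N]) A` is
CARTESIAN** (`A[N M] = [N]⁻¹ A[M]`). [cite: Tate1967, §2 (2.1)] -/
theorem isPullback_torsionMulMap (N M M' : ℕ) (hM : M' = N * M) :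
    IsPullback (A.torsionMulMap N M M' hM) (A.torsionι M') (A.torsionι M) (A.mulN N) := by
  have t := (A.isPullback_torsionι M).flip
  have s := (A.isPullback_torsionι M').flip
  have e1 : toUnit (A.torsion M') = A.torsionMulMap N M M' hM ≫ toUnit (A.torsion M) := toUnit_unique _ _
  have e2 : A.mulN M' = A.mulN N ≫ A.mulN M := by rw [hM, mulN_mul]
  rw [e1, e2] at s
  exact IsPullback.of_right s (A.torsionMulMap_ι N M M' hM) t

/-- The underlying square of schemes `A[N M] →(j) A[M]; A →([N]) A` is cartesian. [cite: Tate1967, §2 (2.1)] -/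
theorem isPullback_torsionMulMap_left (N M M' : ℕ) (hM : M' = N * M) :
    IsPullback (A.torsionMulMap N M M' hM).left (A.torsionι M').left (A.torsionι M).left (A.mulN N).left :=
  (A.isPullback_torsionMulMap N M M' hM).map (Over.forget S)

/-- **`j : A[N M] ⟶ A[M]` is FLAT** for `N ≠ 0` (base change of the flat `[N]_A`). [cite: Tate1967, §2 (2.1)] -/
theorem flat_torsionMulMap_left {N : ℕ} (hN : N ≠ 0) (M M' : ℕ) (hM : M' = N * M) :
    Flat (A.torsionMulMap N M M' hM).left :=
  MorphismProperty.of_isPullback (P := @Flat) (A.isPullback_torsionMulMap_left N M M' hM).flip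
    (A.flat_pow_id_left_of_ne_zero hN)

/-- **`j : A[N M] ⟶ A[M]` is SURJECTIVE** for `N ≠ 0` (base change of the surjective `[N]_A`): with flatness, `[N]` is an
fppf epimorphism `A[N M] → A[M]` — the «`p`-divisibility». [cite: Tate1967, §2 (2.1)] -/
theorem surjective_torsionMulMap_left {N : ℕ} (hN : N ≠ 0) (M M' : ℕ) (hM : M' = N * M) :
    Surjective (A.torsionMulMap N M M' hM).left :=
  MorphismProperty.of_isPullback (P := @Surjective) (A.isPullback_torsionMulMap_left N M M' hM).flip
    (A.surjective_pow_id_left_of_ne_zero hN)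

/-- `j : A[N M] ⟶ A[M]` is FINITE for `N ≠ 0`. [cite: Tate1967, §2 (2.1)] -/
theorem isFinite_torsionMulMap_left {N : ℕ} (hN : N ≠ 0) (M M' : ℕ) (hM : M' = N * M) :
    IsFinite (A.torsionMulMap N M M' hM).left :=
  MorphismProperty.of_isPullback (P := @IsFinite) (A.isPullback_torsionMulMap_left N M M' hM).flip
    (A.isFinite_pow_id_left_of_ne_zero hN)

/-! ## §3 The group structures (commutative `A`) -/

section Group

variable [IsCommMonObj A.X]

/-- **The `S`-GROUP SCHEME structure of `A[N]`** (commutative `A`, so that `[N]` is a homomorphism, ★ `isMonHom_mulN`; the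
kernel of a homomorphism is a group object, ★ `GroupSchemeKernel.grpObjKer`).  A reducible `def`, not an instance: bind
with `letI := A.torsionGrpObj N`. [cite: GortzWedhorn2023, Prop. 27.188 (1)] -/
@[reducible] def torsionGrpObj (N : ℕ) : GrpObj (A.torsion N) :=
  haveI := A.isMonHom_mulN N
  GroupSchemeKernel.grpObjKer (A.mulN N)

/-- `ι : A[N] → A` is a homomorphism. [cite: GortzWedhorn2023, Prop. 27.188 (1)] -/
theorem isMonHom_torsionι (N : ℕ) : letI := A.torsionGrpObj N; IsMonHom (A.torsionι N) := by
  haveI := A.isMonHom_mulN N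
  exact GroupSchemeKernel.isMonHom_kerι (A.mulN N)

/-- `A[N]` is a COMMUTATIVE group scheme (a subgroup scheme of the commutative `A`). [cite: GortzWedhorn2023, Prop. 27.188 (1)] -/
theorem isCommMonObj_torsion (N : ℕ) : letI := A.torsionGrpObj N; IsCommMonObj (A.torsion N) := by
  letI := A.torsionGrpObj N
  haveI := A.isMonHom_torsionι N
  haveI := A.mono_torsionι N
  rw [isCommMonObj_iff_isMulCommutative]
  intro X
  refine ⟨⟨fun a b => ?_⟩⟩
  rw [← cancel_mono (A.torsionι N), MonObj.mul_comp, MonObj.mul_comp, mul_comm]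

/-- On `A[M]`, `[N]_{A[M]} ≫ ι_M = ι_M ≫ [N]_A` (the inclusion is a homomorphism). [cite: GortzWedhorn2023, Prop. 27.188 (1)] -/
theorem id_pow_comp_torsionι (N M : ℕ) :
    letI := A.torsionGrpObj M; ((𝟙 (A.torsion M)) ^ N) ≫ A.torsionι M = A.torsionι M ≫ A.mulN N := by
  letI := A.torsionGrpObj M
  haveI := A.isMonHom_torsionι M
  rw [MonObj.pow_comp, Category.id_comp, comp_mulN]

/-- **`A[N]` is killed by `N`**: `(𝟙 A[N])^N = 1` in `End_S(A[N])`. [cite: GortzWedhorn2023, Prop. 27.188 (1)] -/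
theorem id_pow_eq_one_torsion (N : ℕ) : letI := A.torsionGrpObj N; (𝟙 (A.torsion N)) ^ N = 1 := by
  letI := A.torsionGrpObj N
  haveI := A.isMonHom_torsionι N
  haveI := A.mono_torsionι N
  rw [← cancel_mono (A.torsionι N), id_pow_comp_torsionι, torsionι_comp_mulN, MonObj.one_comp]

/-- `i : A[N] ⟶ A[M]` is a HOMOMORPHISM of `S`-group schemes. [cite: Tate1967, §2 (2.1)] -/
theorem isMonHom_torsionIncl (N M : ℕ) (h : N ∣ M) :
    letI := A.torsionGrpObj N; letI := A.torsionGrpObj M; IsMonHom (A.torsionIncl N M h) := by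
  letI := A.torsionGrpObj N
  haveI := A.isMonHom_torsionι N
  haveI := A.isMonHom_mulN M
  unfold torsionIncl torsionLift
  exact GroupSchemeKernel.isMonHom_kerLift _ _

/-- **`A[N]` IS THE KERNEL OF `[N]` ON `A[M]`** (`N ∣ M`): the square `A[N] →(i) A[M] →([N]) A[M] ←(e) S` is cartesian in
`S`-schemes — Tate's exactness of `0 → G_ν →(i) G_{ν+μ} →(p^ν) G_{ν+μ}`. [cite: Tate1967, §2 (2.1)] -/
theorem isPullback_torsionIncl (N M : ℕ) (h : N ∣ M) :
    letI := A.torsionGrpObj M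
    IsPullback (A.torsionIncl N M h) (toUnit _) ((𝟙 (A.torsion M)) ^ N) η[A.torsion M] := by
  letI := A.torsionGrpObj M
  haveI := A.isMonHom_torsionι M
  haveI := A.mono_torsionι M
  haveI := A.mono_torsionIncl N M h
  have hw : A.torsionIncl N M h ≫ ((𝟙 (A.torsion M)) ^ N) = toUnit _ ≫ η[A.torsion M] := by
    rw [← cancel_mono (A.torsionι M), Category.assoc, Category.assoc, id_pow_comp_torsionι, torsionIncl_ι_assoc,
      torsionι_comp_mulN, IsMonHom.one_hom, ← Hom.one_def]
  refine IsPullback.of_isLimit' ⟨hw⟩ (PullbackCone.IsLimit.mk _ (fun c => ?_) (fun c => ?_) (fun c => ?_)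
    (fun c m hm _ => ?_))
  · -- the lift: `c.fst ≫ ι_M` is killed by `[N]`
    refine A.torsionLift (c.fst ≫ A.torsionι M) ?_
    rw [Category.assoc, ← id_pow_comp_torsionι, ← Category.assoc, c.condition, Category.assoc, IsMonHom.one_hom,
      toUnit_unique c.snd (toUnit _), ← Hom.one_def]
  · rw [← cancel_mono (A.torsionι M), Category.assoc, torsionIncl_ι, torsionLift_ι]
  · exact toUnit_unique _ _
  · apply A.torsion_hom_ext
    rw [torsionLift_ι, ← A.torsionIncl_ι N M h, ← Category.assoc, hm]

/-- `j : A[M′] ⟶ A[M]` is a HOMOMORPHISM. [cite: Tate1967, §2 (2.1)] -/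
theorem isMonHom_torsionMulMap (N M M' : ℕ) (hM : M' = N * M) :
    letI := A.torsionGrpObj M'; letI := A.torsionGrpObj M; IsMonHom (A.torsionMulMap N M M' hM) := by
  letI := A.torsionGrpObj M'
  haveI := A.isMonHom_torsionι M'
  haveI := A.isMonHom_mulN M
  haveI := A.isMonHom_mulN N
  unfold torsionMulMap torsionLift
  exact GroupSchemeKernel.isMonHom_kerLift _ _

/-- **`j ≫ i = [N]` on `A[M′]`** (`M′ = N M`): Tate's `i_ν ∘ j_ν = p`. [cite: Tate1967, §2 (2.1)] -/
theorem torsionMulMap_comp_torsionIncl (N M M' : ℕ) (hM : M' = N * M) (h : M ∣ M') :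
    letI := A.torsionGrpObj M'
    A.torsionMulMap N M M' hM ≫ A.torsionIncl M M' h = (𝟙 (A.torsion M')) ^ N := by
  letI := A.torsionGrpObj M'
  haveI := A.mono_torsionι M'
  rw [← cancel_mono (A.torsionι M'), Category.assoc, torsionIncl_ι, torsionMulMap_ι, id_pow_comp_torsionι]

end Group

/-! ## §4 The `p`-divisible group `A[p^∞]` -/

section PDivisible

variable [IsCommMonObj A.X]

/-- **THE `p`-DIVISIBLE (BARSOTTI–TATE) GROUP `A[p^∞] = (A[p^n])_n` OF AN ABELIAN SCHEME `A → S` OF RELATIVE DIMENSION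
`g` OVER AN ARBITRARY BASE, a Barsotti–Tate group of HEIGHT `2g`** (Tate's example (a) after (2.1): layers `A[p^n]`,
finite locally free of rank `(p^n)^{2g} = p^{n · 2g}` by [GortzWedhorn2023] Prop. 27.188 (1) over any base, inclusions
`A[p^n] ↪ A[p^{n+1}]` identifying `A[p^n]` with the `p^n`-torsion of `A[p^{n+1}]`, and `[p] : A[p^{n+1}] → A[p^n]` finite
flat surjective with `[p] ≫ i = p`).  Hypotheses: the group law of `A` is commutative (a theorem over every locally
Noetherian base, ★ `isCommMonObj_of_isLocallyNoetherian_base`) and `p ≠ 0` (primality is not used by the structure).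
[cite: Tate1967, §2 (2.1)] -/
def pDivisibleGroup {p g : ℕ} (hp : p ≠ 0) (hg : A.IsOfRelDim g) : BTGroup S p (2 * g) where
  G n := A.torsion (p ^ n)
  grpObj n := A.torsionGrpObj (p ^ n)
  comm n := A.isCommMonObj_torsion (p ^ n)
  isFinite n := A.isFinite_torsion_hom (pow_ne_zero n hp)
  flat n := A.flat_torsion_hom (pow_ne_zero n hp)
  finrank_eq n s := by rw [A.finrank_torsion_hom hg (pow_ne_zero n hp) s, ← pow_mul]
  killed n := A.id_pow_eq_one_torsion (p ^ n)
  incl n := A.torsionIncl (p ^ n) (p ^ (n + 1)) (pow_dvd_pow p n.le_succ)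
  incl_isMonHom n := A.isMonHom_torsionIncl _ _ _
  isClosedImmersion_incl n := A.isClosedImmersion_torsionIncl_left _ _ _
  isPullback_incl n := A.isPullback_torsionIncl _ _ _
  pMap n := A.torsionMulMap p (p ^ n) (p ^ (n + 1)) (pow_succ' p n)
  pMap_incl n := A.torsionMulMap_comp_torsionIncl _ _ _ _ _
  pMap_isMonHom n := A.isMonHom_torsionMulMap _ _ _ _
  flat_pMap n := A.flat_torsionMulMap_left hp _ _ _
  surjective_pMap n := A.surjective_torsionMulMap_left hp _ _ _

/-- The transitions of `A[p^∞]` are the inclusions `A[p^n] ↪ A[p^{n+1}]` (unfolding). [cite: Tate1967, §2 (2.1)] -/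
theorem pDivisibleGroup_incl {p g : ℕ} (hp : p ≠ 0) (hg : A.IsOfRelDim g) (n : ℕ) :
    (A.pDivisibleGroup hp hg).incl n = A.torsionIncl (p ^ n) (p ^ (n + 1)) (pow_dvd_pow p n.le_succ) :=
  rfl

end PDivisible

/-- The underlying scheme of `A[N]` IS the fibre product `S ×_{e, A, [N]} A` of Mathlib's `pullback` API (the socket's
shape, ★ `finrank_fst_unit_pow_id_of_ne_zero`'s idiom). [cite: GortzWedhorn2023, Prop. 27.188 (1)] -/
def torsionIsoPullback (N : ℕ) :
    (A.torsion N).left ≅ pullback (η[A.X] : 𝟙_ (Over S) ⟶ A.X).left (((𝟙 A.X : A.X ⟶ A.X) ^ N : A.X ⟶ A.X).left) :=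
  (A.isPullback_torsionι_left N).flip.isoPullback

/-- `torsionIsoPullback ≫ snd = ι`. [cite: GortzWedhorn2023, Prop. 27.188 (1)] -/
@[reassoc]
theorem torsionIsoPullback_hom_snd (N : ℕ) :
    (A.torsionIsoPullback N).hom ≫ pullback.snd _ _ = (A.torsionι N).left :=
  (A.isPullback_torsionι_left N).flip.isoPullback_hom_snd

/-- `torsionIsoPullback ≫ fst = (A[N] → S)`. [cite: GortzWedhorn2023, Prop. 27.188 (1)] -/
@[reassoc]
theorem torsionIsoPullback_hom_fst (N : ℕ) :
    (A.torsionIsoPullback N).hom ≫ pullback.fst _ _ = (A.torsion N).hom :=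
  (A.isPullback_torsionι_left N).flip.isoPullback_hom_fst

/-- **`A[p^∞]` IS the `p`-divisible group of `A` in the sense of the socket `BTGroup.IsOfAbelianScheme`**: the inclusions
`ι : A[p^n] ⟶ A` are homomorphisms exhibiting each layer as the kernel of `[p^n]` (cartesian square in `Over S`), compatibly
with the transitions. [cite: Tate1967, §2 (2.1)] -/
theorem isOfAbelianScheme_pDivisibleGroup [IsCommMonObj A.X] {p g : ℕ} (hp : p ≠ 0) (hg : A.IsOfRelDim g) :
    (A.pDivisibleGroup hp hg).IsOfAbelianScheme A :=
  ⟨fun n => A.torsionι (p ^ n), fun n => A.isMonHom_torsionι (p ^ n), fun n => A.isPullback_torsionι (p ^ n),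
    fun n => A.torsionIncl_ι (p ^ n) (p ^ (n + 1)) (pow_dvd_pow p n.le_succ)⟩

/-- **EXISTENCE, hypothesis-light form**: every abelian scheme of relative dimension `g` with commutative group law over
ANY base scheme has a `p`-divisible group of height `2g` for every `p ≠ 0`. [cite: Tate1967, §2 (2.1)] -/
theorem exists_btGroup_isOfAbelianScheme [IsCommMonObj A.X] {p g : ℕ} (hp : p ≠ 0) (hg : A.IsOfRelDim g) :
    ∃ B : BTGroup S p (2 * g), B.IsOfAbelianScheme A :=
  ⟨A.pDivisibleGroup hp hg, A.isOfAbelianScheme_pDivisibleGroup hp hg⟩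

/-- **EXISTENCE over a locally Noetherian base, no commutativity binder** (★ `isCommMonObj_of_isLocallyNoetherian_base`,
[MumfordFogartyKirwan1994] Cor. 6.5). [cite: Tate1967, §2 (2.1)] -/
theorem exists_btGroup_isOfAbelianScheme_of_isLocallyNoetherian [IsLocallyNoetherian S] {p g : ℕ} (hp : p ≠ 0)
    (hg : A.IsOfRelDim g) : ∃ B : BTGroup S p (2 * g), B.IsOfAbelianScheme A := by
  haveI := A.isCommMonObj_of_isLocallyNoetherian_base
  exact A.exists_btGroup_isOfAbelianScheme hp hg

end AbelianSchemeOver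

end Literature.AlgebraicGeometry.AbelianSchemes

end
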